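import Summits.AtomisticToContinuum.BoseEinsteinCondensation.Theses.BECInfraredBound
import Summits.AtomisticToContinuum.BoseEinsteinCondensation.Theorems.BECCutLineWeakDisorderGroundStateRigidityEssBounded
import Summits.AtomisticToContinuum.BoseEinsteinCondensation.Theorems.BECStoquasticCensoringScatteringLengthPos
import Literature.MathematicalPhysics.QuantumManyBody.LiebYngvasonTheorem
import Literature.MathematicalPhysics.QuantumManyBody.LiebYngvasonCellMethod
import Literature.MathematicalPhysics.QuantumManyBody.DiluteBoseGasUpperBoundLocalization
import Literature.MathematicalPhysics.QuantumManyBody.BoseGasFreeDirichletBEC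
import Literature.MathematicalPhysics.QuantumManyBody.BoseGasThermodynamicLimitRuelle

/-!
# Line `cell-jensen` — crux `BecShellMass` (stmt-AtomisticToContinuum-0734), route `BECInfraredBound`
# file `Cruxes/BecShellMass/Lines/cell-jensen.lean` (crux-strategist, 2026-08-17)

The crux (by name, `Summit.AtomisticToContinuum.BoseEinsteinCondensation.Theses.BECInfraredBound.BecShellMass`):
NO BOUNDARY ACCUMULATION — for every repulsive finite-range `v` there is `C` such that for every
`ε ∈ (0, 1/4)`, some `ρ₀(ε) > 0`, all `0 < ρ < ρ₀`, all large `N`, some `δ > 0` and every Dirichlet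
`δ`-near-minimiser `Ψ` in the box of side `L = (N/ρ)^{1/3}`, the expected number of particles in the
shell `Λ_L ∖ (εL, L−εL)³` is `≤ C ε N`.

## The line (typed): TWO BRANCHES on whether `v` is a.e. zero on `(0, ∞)`

* FREE (`v` a.e. zero; glue proved here from the tree: `energy v = energy 0`, `E₀(v) = E₀(0) ≤ E₁ N/L²`,
  `E₁ =` energy of the unit bump): `stub_boundaryLayerPoincare` — a Dirichlet trial state has at most
  `w² · (kinetic energy)` particles within sup-distance `w` of `∂Λ_L` (1-D `f(0) = 0 ⇒ ∫₀ʷ|f|² ≤ (w²/2)∫₀ʷ|f'|²`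
  on the lines normal to the six faces). With `w = εL`: shell mass `≤ ε²L²·(E₁+1)N/L² ≤ (E₁+1) ε N`.
* INTERACTING (`a(v) > 0`, by the tree's `scatteringLength_ne_zero_of_not_ae_zero`): the Lieb–Yngvason
  CELL METHOD run on the trial state itself, not on the infimum.
  - `stub_gridJensen` (trial-state form of LSSY (2.52) + finite Jensen, two colours): on the uniform grid of
    `M³` open cells of side `L/M`, with the `m` outer layers coloured "shell" (`K_S = M³ − (M−2m)³` cells) and
    the rest "bulk" (`K_B = (M−2m)³`), every convex `g ≥ 0` on `[0,∞)` minorising the Neumann cell energies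
    `n ↦ E₀^Neu(n, L/M)` gives `energy v Ψ ≥ K_S g(N_S/K_S) + K_B g((N−N_S)/K_B)`, `N_S` the expected
    number of particles in the closed grid shell (tree: `sum_neumannGroundStateEnergy_mul_le_setLIntegral_cellSet`,
    `boxN_ae_eq_iUnion_cellSet`; Mathlib `ConvexOn.map_sum_le`).
  - `stub_cellMinorant` (the hardest): from LSSY Thm 2.4 with NEUMANN conditions (tree:
    `LSSY2005_lowerBound_neumann_holds`) inside one cell and superadditivity (tree:
    `LSSY2005_superadditivity_holds`), the map `n ↦ E₀^Neu(n, ℓ)` has a convex minorant `g ≥ 0` with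
    `g(t) ≥ 4πa(1−η)t²/ℓ³ − θℓ³` on the dilute range `t ≤ ρ₁(η)ℓ³`, for every defect `θ > 0` once `ℓ ≥ ℓ₀(θ)`
    (construction: `κt²` up to `p/2`, tangent-linear beyond, minus `κ n_min²` for the few-particle cells below
    the LY size threshold `n_min ~ (ℓ/a)^{1/6}`, truncated at `0`).
  - GLUE proved here (sorry-free): the grid (`M = ⌊L/ℓ₀⌋`, `m = ⌊εM⌋+1`, so `mL/M ≥ εL` and the crux's shell
    sits inside the grid shell), the shell fraction `s = K_S/M³ ∈ [2ε, 27ε/4]`, `1 − s ≥ 1/16`, the Dyson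
    upper bound `E₀ ≤ 4πρa(1 + C_U(ρa³)^{1/3})N` eventually (tree: `eventually_groundStateEnergy_le_dyson`)
    with `C_U(ρa³)^{1/3} ≤ ε/8` below `ρ_D(ε)`, `η = ε/8`, `θ = 4πaρ²ε/8`, `δ = 4πaρN·ε/8`, and the algebra:
    `(1 − ε/8)(x²/s + (1−x)²/(1−s)) ≤ 1 + 3ε/8` with `x = N_S/N` forces `(x − s)² ≤ εs`, i.e.
    `x ≤ (3s + ε)/2 ≤ 85ε/8`; hence `C = 12`.

Composition: `becShellMass_of_stubs : Stmt.stub_boundaryLayerPoincare → Stmt.stub_gridJensen →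
Stmt.stub_cellMinorant → BecShellMass` (kernel-checked, `by_cases` on the a.e.-zero dichotomy), and
`BecShellMass_of : BECInfraredBound.BecShellMass` — the crux BY NAME from the three registered stubs.

Disproof used: none exists for this crux (`ledger crux ls stmt-AtomisticToContinuum-0734`: no workfiles,
2026-08-17); the summit's negatives index (20 entries) has nothing on boundary mass. Honoured refuter evidence on
the item: the free gas `v ≡ 0` is admissible (g12-5 read-back) — handled by its own branch, where the cell
method is void (`a = 0`) but the Dirichlet kinetic scale `1/L²` makes the boundary layer cheap to exclude.
-/

noncomputable section

namespace Summit.AtomisticToContinuum.BoseEinsteinCondensation.Cruxes.BecShellMass.CellJensen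

open Literature.MathematicalPhysics.QuantumManyBody.BoseGas
open _root_.MeasureTheory _root_.Filter
open scoped ENNReal Topology
open Summit.AtomisticToContinuum.BoseEinsteinCondensation.Theses

/-! ### Stub statements (namespace `Stmt`) -/

namespace Stmt

/-- **Stub `stub_boundaryLayerPoincare`** (boundary-layer Poincaré inequality for Dirichlet trial
states): the expected number of particles within sup-distance `w` of the boundary of the box is at most
`w²` times the kinetic energy (`f(0) = 0 ⇒ ∫₀ʷ |f|² ≤ (w²/2) ∫₀ʷ |f'|²` on every line normal to a face,
summed over the six faces). -/
def stub_boundaryLayerPoincare : Prop :=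
  ∀ (N : ℕ) (L w : ℝ), 0 < w → 2 * w ≤ L →
    ∀ Ψ : Literature.MathematicalPhysics.QuantumManyBody.BoseGas.TrialState N L,
      (∑ i : Fin N, ∫⁻ X, {x : EuclideanSpace ℝ (Fin 3) | ∀ j, x j ∈ Set.Ioo w (L - w)}ᶜ.indicator
          (fun _ => (1 : ℝ≥0∞)) (X i) * (‖Ψ.ψ X‖₊ : ℝ≥0∞) ^ 2) ≤
        ENNReal.ofReal (w ^ 2) *
          ∫⁻ X, Literature.MathematicalPhysics.QuantumManyBody.BoseGas.kineticDensity Ψ.ψ X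

/-- **Stub `stub_gridJensen`** (trial-state cell method + Jensen, two colours): on the uniform grid of
`M³` open cells of side `L/M` in `Λ_L`, colour the `m` outer layers "shell" (`K_S = M³ − (M−2m)³` cells)
and the rest "bulk" (`K_B = (M−2m)³` cells). For every convex `g ≥ 0` on `[0, ∞)` minorising the Neumann
cell energies `n ↦ E₀^Neu(n, L/M)`, every Dirichlet trial state has
`energy ≥ K_S g(N_S/K_S) + K_B g((N − N_S)/K_B)`, `N_S` = expected number of particles in the closed
grid shell (complement of the open bulk cube `(mL/M, L − mL/M)³`). -/
def stub_gridJensen : Prop :=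
  ∀ (v : ℝ → ℝ≥0∞), Measurable v → ∀ (N M m : ℕ) (L : ℝ), 0 < L → 0 < m → 2 * m < M →
    ∀ g : ℝ → ℝ, ConvexOn ℝ (Set.Ici (0 : ℝ)) g → (∀ t : ℝ, 0 ≤ t → 0 ≤ g t) →
      (∀ n : ℕ, ENNReal.ofReal (g n) ≤
        Literature.MathematicalPhysics.QuantumManyBody.BoseGas.neumannGroundStateEnergy v n (L / M)) →
      ∀ Ψ : Literature.MathematicalPhysics.QuantumManyBody.BoseGas.TrialState N L,
        ENNReal.ofReal
            ((((M : ℝ) ^ 3 - ((M : ℝ) - 2 * m) ^ 3)) *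
                g ((∑ i : Fin N, ∫⁻ X, {x : EuclideanSpace ℝ (Fin 3) |
                      ∀ j, x j ∈ Set.Ioo ((m : ℝ) * (L / M)) (L - (m : ℝ) * (L / M))}ᶜ.indicator
                      (fun _ => (1 : ℝ≥0∞)) (X i) * (‖Ψ.ψ X‖₊ : ℝ≥0∞) ^ 2).toReal /
                    ((M : ℝ) ^ 3 - ((M : ℝ) - 2 * m) ^ 3)) +
              ((M : ℝ) - 2 * m) ^ 3 *
                g (((N : ℝ) - (∑ i : Fin N, ∫⁻ X, {x : EuclideanSpace ℝ (Fin 3) |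
                      ∀ j, x j ∈ Set.Ioo ((m : ℝ) * (L / M)) (L - (m : ℝ) * (L / M))}ᶜ.indicator
                      (fun _ => (1 : ℝ≥0∞)) (X i) * (‖Ψ.ψ X‖₊ : ℝ≥0∞) ^ 2).toReal) /
                    ((M : ℝ) - 2 * m) ^ 3)) ≤
          Literature.MathematicalPhysics.QuantumManyBody.BoseGas.energy v Ψ

/-- **Stub `stub_cellMinorant`** (Lieb–Yngvason convex minorant of the Neumann cell energy): for
`0 < a < ∞` and `η ∈ (0,1)` there is a density `ρ₁ > 0` such that for every defect `θ > 0` and all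
large cells `ℓ ≥ ℓ₀(θ)` the map `n ↦ E₀^Neu(n, ℓ)` admits a convex minorant `g ≥ 0` on `[0, ∞)` with
`g(t) ≥ 4πa(1−η)t²/ℓ³ − θℓ³` for `0 ≤ t ≤ ρ₁ℓ³` (LSSY Thm 2.4, Neumann, inside each cell; superadditivity
above the dilute range; the configurations below the LY size threshold cost the defect). -/
def stub_cellMinorant : Prop :=
  ∀ (v : ℝ → ℝ≥0∞), Literature.MathematicalPhysics.QuantumManyBody.BoseGas.IsRepulsiveFiniteRange v →
    Literature.MathematicalPhysics.QuantumManyBody.BoseGas.scatteringLength v ≠ ⊤ →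
    0 < Literature.MathematicalPhysics.QuantumManyBody.BoseGas.scatteringLength v →
    ∀ η : ℝ, 0 < η → η < 1 → ∃ ρ₁ : ℝ, 0 < ρ₁ ∧ ∀ θ : ℝ, 0 < θ → ∃ ℓ₀ : ℝ, 0 < ℓ₀ ∧
      ∀ ℓ : ℝ, ℓ₀ ≤ ℓ → ∃ g : ℝ → ℝ, ConvexOn ℝ (Set.Ici (0 : ℝ)) g ∧ (∀ t : ℝ, 0 ≤ t → 0 ≤ g t) ∧
        (∀ n : ℕ, ENNReal.ofReal (g n) ≤
          Literature.MathematicalPhysics.QuantumManyBody.BoseGas.neumannGroundStateEnergy v n ℓ) ∧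
        (∀ t : ℝ, 0 ≤ t → t ≤ ρ₁ * ℓ ^ 3 →
          4 * Real.pi * (Literature.MathematicalPhysics.QuantumManyBody.BoseGas.scatteringLength v).toReal *
              (1 - η) * t ^ 2 / ℓ ^ 3 - θ * ℓ ^ 3 ≤ g t)

end Stmt

/-! ### Registered stubs -/

/-- stub (M: 1-D `f(0)=0 ⇒ ∫|f|² ≤ (w²/2)∫|f'|²` on lines normal to the faces + Fubini;
type = `Stmt.stub_boundaryLayerPoincare`). -/
theorem stub_boundaryLayerPoincare : ∀ (N : ℕ) (L w : ℝ), 0 < w → 2 * w ≤ L → ∀ Ψ : Literature.MathematicalPhysics.QuantumManyBody.BoseGas.TrialState N L, (∑ i : Fin N, ∫⁻ X, {x : EuclideanSpace ℝ (Fin 3) | ∀ j, x j ∈ Set.Ioo w (L - w)}ᶜ.indicator (fun _ => (1 : ℝ≥0∞)) (X i) * (‖Ψ.ψ X‖₊ : ℝ≥0∞) ^ 2) ≤ ENNReal.ofReal (w ^ 2) * ∫⁻ X, Literature.MathematicalPhysics.QuantumManyBody.BoseGas.kineticDensity Ψ.ψ X := by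
  sorry

/-- stub (M–L: histogram form of LSSY (2.52) — `sum_neumannGroundStateEnergy_mul_le_setLIntegral_cellSet`
summed over assignments — plus finite Jensen for the two colour classes; type = `Stmt.stub_gridJensen`). -/
theorem stub_gridJensen : ∀ (v : ℝ → ℝ≥0∞), Measurable v → ∀ (N M m : ℕ) (L : ℝ), 0 < L → 0 < m → 2 * m < M → ∀ g : ℝ → ℝ, ConvexOn ℝ (Set.Ici (0 : ℝ)) g → (∀ t : ℝ, 0 ≤ t → 0 ≤ g t) → (∀ n : ℕ, ENNReal.ofReal (g n) ≤ Literature.MathematicalPhysics.QuantumManyBody.BoseGas.neumannGroundStateEnergy v n (L / M)) → ∀ Ψ : Literature.MathematicalPhysics.QuantumManyBody.BoseGas.TrialState N L, ENNReal.ofReal ((((M : ℝ) ^ 3 - ((M : ℝ) - 2 * m) ^ 3)) * g ((∑ i : Fin N, ∫⁻ X, {x : EuclideanSpace ℝ (Fin 3) | ∀ j, x j ∈ Set.Ioo ((m : ℝ) * (L / M)) (L - (m : ℝ) * (L / M))}ᶜ.indicator (fun _ => (1 : ℝ≥0∞)) (X i) * (‖Ψ.ψ X‖₊ : ℝ≥0∞)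 ^ 2).toReal / ((M : ℝ) ^ 3 - ((M : ℝ) - 2 * m) ^ 3)) + ((M : ℝ) - 2 * m) ^ 3 * g (((N : ℝ) - (∑ i : Fin N, ∫⁻ X, {x : EuclideanSpace ℝ (Fin 3) | ∀ j, x j ∈ Set.Ioo ((m : ℝ) * (L / M)) (L - (m : ℝ) * (L / M))}ᶜ.indicator (fun _ => (1 : ℝ≥0∞)) (X i) * (‖Ψ.ψ X‖₊ : ℝ≥0∞) ^ 2).toReal) / ((M : ℝ) - 2 * m) ^ 3)) ≤ Literature.MathematicalPhysics.QuantumManyBody.BoseGas.energy v Ψ := by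
  sorry

/-- stub (M–L, the hardest: LSSY Thm 2.4 (Neumann, in tree) cell by cell + superadditivity with
remainder + the convex extension; type = `Stmt.stub_cellMinorant`). -/
theorem stub_cellMinorant : ∀ (v : ℝ → ℝ≥0∞), Literature.MathematicalPhysics.QuantumManyBody.BoseGas.IsRepulsiveFiniteRange v → Literature.MathematicalPhysics.QuantumManyBody.BoseGas.scatteringLength v ≠ ⊤ → 0 < Literature.MathematicalPhysics.QuantumManyBody.BoseGas.scatteringLength v → ∀ η : ℝ, 0 < η → η < 1 → ∃ ρ₁ : ℝ, 0 < ρ₁ ∧ ∀ θ : ℝ, 0 < θ → ∃ ℓ₀ : ℝ, 0 < ℓ₀ ∧ ∀ ℓ : ℝ, ℓ₀ ≤ ℓ → ∃ g : ℝ → ℝ, ConvexOn ℝ (Set.Ici (0 : ℝ)) g ∧ (∀ t : ℝ, 0 ≤ t → 0 ≤ g t) ∧ (∀ n : ℕ, ENNReal.ofReal (g n) ≤ Literature.MathematicalPhysics.QuantumManyBody.BoseGas.neumannGroundStateEnergy v n ℓ) ∧ (∀ t : ℝ, 0 ≤ t → t ≤ ρ₁ * ℓ ^ 3 → 4 * Real.pi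 * (Literature.MathematicalPhysics.QuantumManyBody.BoseGas.scatteringLength v).toReal * (1 - η) * t ^ 2 / ℓ ^ 3 - θ * ℓ ^ 3 ≤ g t) := by
  sorry

example : Stmt.stub_boundaryLayerPoincare := stub_boundaryLayerPoincare
example : Stmt.stub_gridJensen := stub_gridJensen
example : Stmt.stub_cellMinorant := stub_cellMinorant

/-! ### Sorry-free glue -/

/-- `L = (N/ρ)^{1/3} > 0` for `ρ > 0`, `N ≥ 1`. [folklore] -/
theorem sideLength_pos' {ρ : ℝ} (hρ : 0 < ρ) {N : ℕ} (hN : 0 < N) : 0 < sideLength ρ N := by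
  unfold sideLength
  exact Real.rpow_pos_of_pos (div_pos (Nat.cast_pos.2 hN) hρ) _

/-- **The interaction is invisible when `v` is a.e. zero on `(0, ∞)`** (as in the `BecFreeGas` birth
line): the exceptional radii form a null set off which `v` agrees with a potential vanishing on
`[0, ∞)`; `GroundStateRigidity.energy_congr_offNull` (tree) does the measure theory. [folklore] -/
theorem energy_eq_energy_zero {v : ℝ → ℝ≥0∞} (hv : IsRepulsiveFiniteRange v)
    (hae : ∀ᵐ r ∂(volume.restrict (Set.Ioi (0 : ℝ))), v r = 0) {N : ℕ} {L : ℝ}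
    (Ψ : TrialState N L) : energy v Ψ = energy 0 Ψ := by
  have hSm : MeasurableSet (({0} : Set ℝ) ∪ (Set.Ioi 0 ∩ v ⁻¹' {0}ᶜ)) :=
    (measurableSet_singleton 0).union (measurableSet_Ioi.inter (hv.1 (measurableSet_singleton 0).compl))
  have hpos : volume (Set.Ioi (0 : ℝ) ∩ v ⁻¹' {0}ᶜ) = 0 := by
    have h1 : (volume.restrict (Set.Ioi (0 : ℝ))) {r | ¬ v r = 0} = 0 := ae_iff.1 hae
    rw [Measure.restrict_apply' measurableSet_Ioi] at h1
    refine measure_mono_null (fun r hr => ?_) h1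
    exact ⟨hr.2, hr.1⟩
  have hS0 : volume (({0} : Set ℝ) ∪ (Set.Ioi 0 ∩ v ⁻¹' {0}ᶜ)) = 0 :=
    measure_union_null Real.volume_singleton hpos
  have hvw : ∀ r, r ∉ (({0} : Set ℝ) ∪ (Set.Ioi 0 ∩ v ⁻¹' {0}ᶜ)) →
      v r = (fun s : ℝ => if 0 ≤ s then (0 : ℝ≥0∞) else v s) r := by
    intro r hr
    by_cases h0 : 0 ≤ r
    · have hv0 : v r = 0 := by
        by_contra hne
        rcases h0.eq_or_lt with h00 | h00
        · exact hr (Set.mem_union_left _ (Set.mem_singleton_iff.2 h00.symm))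
        · exact hr (Set.mem_union_right _ (Set.mem_inter (Set.mem_Ioi.2 h00) (by simpa using hne)))
      simp only [if_pos h0, hv0]
    · simp only [if_neg h0]
  have h1 : energy v Ψ = energy (fun s : ℝ => if 0 ≤ s then (0 : ℝ≥0∞) else v s) Ψ :=
    Summit.AtomisticToContinuum.BoseEinsteinCondensation.Theorems.GroundStateRigidity.energy_congr_offNull
      hSm hS0 hvw Ψ
  have hw0 : ∀ X : Config N, interaction (fun s : ℝ => if 0 ≤ s then (0 : ℝ≥0∞) else v s) X = 0 := by
    intro X
    unfold interaction
    exact Finset.sum_eq_zero fun i _ => Finset.sum_eq_zero fun j _ => by simp [dist_nonneg]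
  have h2 : energy (fun s : ℝ => if 0 ≤ s then (0 : ℝ≥0∞) else v s) Ψ = energy 0 Ψ := by
    simp only [energy, hw0, interaction_zeroPotential]
  rw [h1, h2]

/-- … hence the ground-state energies agree too. [folklore] -/
theorem groundStateEnergy_eq_zero {v : ℝ → ℝ≥0∞} (hv : IsRepulsiveFiniteRange v)
    (hae : ∀ᵐ r ∂(volume.restrict (Set.Ioi (0 : ℝ))), v r = 0) (N : ℕ) (L : ℝ) :
    groundStateEnergy v N L = groundStateEnergy 0 N L := by
  unfold groundStateEnergy
  exact iInf_congr fun Φ => energy_eq_energy_zero hv hae Φ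

/-- The expected number of particles in any one-body region is at most `N`. [folklore] -/
theorem shellMass_le {N : ℕ} {L : ℝ} (Ψ : TrialState N L) (A : Set Space) :
    (∑ i : Fin N, ∫⁻ X, A.indicator (fun _ => (1 : ℝ≥0∞)) (X i) * (‖Ψ.ψ X‖₊ : ℝ≥0∞) ^ 2) ≤
      (N : ℝ≥0∞) := by
  calc (∑ i : Fin N, ∫⁻ X, A.indicator (fun _ => (1 : ℝ≥0∞)) (X i) * (‖Ψ.ψ X‖₊ : ℝ≥0∞) ^ 2)
      ≤ ∑ _i : Fin N, ∫⁻ X, (‖Ψ.ψ X‖₊ : ℝ≥0∞) ^ 2 := by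
        refine Finset.sum_le_sum fun i _ => lintegral_mono fun X => ?_
        calc A.indicator (fun _ => (1 : ℝ≥0∞)) (X i) * (‖Ψ.ψ X‖₊ : ℝ≥0∞) ^ 2
            ≤ 1 * (‖Ψ.ψ X‖₊ : ℝ≥0∞) ^ 2 := by
              gcongr
              exact Set.indicator_le_self' (fun _ _ => zero_le_one) (X i)
          _ = _ := one_mul _
    _ = N := by simp [Ψ.norm_eq]

/-- Monotonicity of the shell mass in the shell width: the shell `{x ∉ (w', L-w')³}` contains the shell
`{x ∉ (w, L-w)³}` for `w ≤ w'`. [folklore] -/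
theorem shellMass_mono {N : ℕ} {L : ℝ} (Ψ : TrialState N L) {w w' : ℝ} (hw : w ≤ w') :
    (∑ i : Fin N, ∫⁻ X, {x : Space | ∀ j, x j ∈ Set.Ioo w (L - w)}ᶜ.indicator
        (fun _ => (1 : ℝ≥0∞)) (X i) * (‖Ψ.ψ X‖₊ : ℝ≥0∞) ^ 2) ≤
    (∑ i : Fin N, ∫⁻ X, {x : Space | ∀ j, x j ∈ Set.Ioo w' (L - w')}ᶜ.indicator
        (fun _ => (1 : ℝ≥0∞)) (X i) * (‖Ψ.ψ X‖₊ : ℝ≥0∞) ^ 2) := by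
  refine Finset.sum_le_sum fun i _ => lintegral_mono fun X => ?_
  refine mul_le_mul_right' ?_ _
  refine Set.indicator_le_indicator_of_subset ?_ (fun _ => zero_le_one) _
  intro x hx hx'
  exact hx fun j => ⟨by linarith [(hx' j).1], by linarith [(hx' j).2]⟩

/-- **Endgame** (pure real algebra, normalised and denominator-free): if
`(1 - e/8)(x²(1-s) + (1-x)² s) ≤ (1 + 3e/8) s(1-s)` then `x ≤ (3s + e)/2`, because
`x²(1-s) + (1-x)²s = (x-s)² + s(1-s)`. [folklore] -/
theorem endgame {x s e : ℝ} (hs : 0 < s) (hs1 : s < 1) (he : 0 < e) (he1 : e ≤ 1)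
    (h : (1 - e / 8) * (x ^ 2 * (1 - s) + (1 - x) ^ 2 * s) ≤ (1 + 3 * e / 8) * (s * (1 - s))) :
    x ≤ (3 * s + e) / 2 := by
  have hid : x ^ 2 * (1 - s) + (1 - x) ^ 2 * s = (x - s) ^ 2 + s * (1 - s) := by ring
  rw [hid] at h
  have hs1' : 0 < 1 - s := by linarith
  have h1a : (1 - e / 8) * (x - s) ^ 2 ≤ (e / 2) * (s * (1 - s)) := by linear_combination h
  have h1 : (1 - e / 8) * (x - s) ^ 2 ≤ (e / 2) * s := by
    nlinarith [h1a, mul_pos (mul_pos he hs) hs]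
  have h2 : (x - s) ^ 2 ≤ e * s := by
    nlinarith [h1, mul_nonneg (sub_nonneg.2 he1) (sq_nonneg (x - s)), sq_nonneg (x - s), mul_pos he hs]
  by_cases hxs : x ≤ s
  · linarith
  · push Not at hxs
    have h3 : (x - s) ^ 2 ≤ ((e + s) / 2) ^ 2 := by nlinarith [sq_nonneg (e - s)]
    have hb : 0 ≤ (e + s) / 2 := by positivity
    have h4 : x - s ≤ (e + s) / 2 := (pow_le_pow_iff_left₀ (by linarith) hb two_ne_zero).1 h3
    linarith

/-- **The convexity step, un-normalised.** From the two-colour Jensen bound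
`K_S g₁ + K_B g₂ ≤ PρN(1 + CY) + PρN e/8` (`P = 4πa`), the minorant's quadratic guarantee at the two
average occupations, the volumes `K_S ℓ³ = s N/ρ`, `K_B ℓ³ = (1-s) N/ρ` and `CY ≤ e/8`:
`S ≤ (3s + e)/2 · N`. [folklore] -/
theorem algebra {P ρ N S KS KB ℓ s e CY g₁ g₂ : ℝ}
    (hP : 0 < P) (hρ : 0 < ρ) (hN : 0 < N) (he : 0 < e) (he1 : e ≤ 1)
    (hs : 0 < s) (hs1 : s < 1) (hS0 : 0 ≤ S) (hKS : 0 < KS) (hKB : 0 < KB)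
    (hℓ : 0 < ℓ) (hVS : KS * ℓ ^ 3 = s * (N / ρ)) (hVB : KB * ℓ ^ 3 = (1 - s) * (N / ρ))
    (hCY : CY ≤ e / 8)
    (hE1 : KS * g₁ + KB * g₂ ≤ P * ρ * N * (1 + CY) + P * ρ * N * (e / 8))
    (hg₁ : P * (1 - e / 8) * (S / KS) ^ 2 / ℓ ^ 3 - P * ρ ^ 2 * (e / 8) * ℓ ^ 3 ≤ g₁)
    (hg₂ : P * (1 - e / 8) * ((N - S) / KB) ^ 2 / ℓ ^ 3 - P * ρ ^ 2 * (e / 8) * ℓ ^ 3 ≤ g₂) :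
    S ≤ (3 * s + e) / 2 * N := by
  have hℓ3 : 0 < ℓ ^ 3 := by positivity
  have hs1' : 0 < 1 - s := by linarith
  set VS : ℝ := KS * ℓ ^ 3 with hVSdef
  set VB : ℝ := KB * ℓ ^ 3 with hVBdef
  have h1 : P * (1 - e / 8) * S ^ 2 / VS - P * ρ ^ 2 * (e / 8) * VS ≤ KS * g₁ := by
    have h := mul_le_mul_of_nonneg_left hg₁ hKS.le
    have hid : KS * (P * (1 - e / 8) * (S / KS) ^ 2 / ℓ ^ 3 - P * ρ ^ 2 * (e / 8) * ℓ ^ 3) =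
        P * (1 - e / 8) * S ^ 2 / VS - P * ρ ^ 2 * (e / 8) * VS := by
      rw [hVSdef]
      field_simp
    linarith [h, hid]
  have h2 : P * (1 - e / 8) * (N - S) ^ 2 / VB - P * ρ ^ 2 * (e / 8) * VB ≤ KB * g₂ := by
    have h := mul_le_mul_of_nonneg_left hg₂ hKB.le
    have hid : KB * (P * (1 - e / 8) * ((N - S) / KB) ^ 2 / ℓ ^ 3 - P * ρ ^ 2 * (e / 8) * ℓ ^ 3) =
        P * (1 - e / 8) * (N - S) ^ 2 / VB - P * ρ ^ 2 * (e / 8) * VB := by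
      rw [hVBdef]
      field_simp
    linarith [h, hid]
  have hE1' : KS * g₁ + KB * g₂ ≤ P * ρ * N * (1 + e / 8) + P * ρ * N * (e / 8) := by
    have : P * ρ * N * (1 + CY) ≤ P * ρ * N * (1 + e / 8) := by
      have hPρN : 0 < P * ρ * N := by positivity
      nlinarith
    linarith
  have h3 : P * (1 - e / 8) * S ^ 2 / VS + P * (1 - e / 8) * (N - S) ^ 2 / VB ≤
      P * ρ * N * (1 + 3 * e / 8) := by
    have hsum : P * ρ ^ 2 * (e / 8) * VS + P * ρ ^ 2 * (e / 8) * VB = P * ρ * N * (e / 8) := by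
      rw [hVS, hVB]; field_simp; ring
    linarith [h1, h2, hE1', hsum]
  have h4 : (1 - e / 8) * ((S / N) ^ 2 * (1 - s) + (1 - S / N) ^ 2 * s) ≤
      (1 + 3 * e / 8) * (s * (1 - s)) := by
    rw [hVS, hVB] at h3
    have hPρN : 0 < P * ρ * N := by positivity
    have key : P * (1 - e / 8) * S ^ 2 / (s * (N / ρ)) +
        P * (1 - e / 8) * (N - S) ^ 2 / ((1 - s) * (N / ρ)) =
        P * ρ * N * ((1 - e / 8) * ((S / N) ^ 2 * (1 - s) + (1 - S / N) ^ 2 * s) / (s * (1 - s))) := by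
      field_simp
    rw [key] at h3
    have h5 : (1 - e / 8) * ((S / N) ^ 2 * (1 - s) + (1 - S / N) ^ 2 * s) / (s * (1 - s)) ≤
        1 + 3 * e / 8 := le_of_mul_le_mul_left (by linarith [h3]) hPρN
    rwa [div_le_iff₀ (mul_pos hs hs1')] at h5
  have hx := endgame hs hs1 he he1 h4
  rw [div_le_iff₀ hN] at hx
  linarith [hx]

/-- **The grid.** Given the cell scale `ℓ₀` and a box of side `L ≥ ℓ₀ (8/ε + 2)`: `M = ⌊L/ℓ₀⌋` cells per
axis (so the cell side `L/M ≥ ℓ₀`) and `m = ⌊εM⌋ + 1` shell layers (so `mL/M ≥ εL`). [folklore] -/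
theorem grid_choice {ε ℓ₀ L : ℝ} (hε : 0 < ε) (hε4 : ε < 1 / 4) (hℓ₀ : 0 < ℓ₀)
    (hL : ℓ₀ * (8 / ε + 2) ≤ L) :
    ∃ M m : ℕ, 0 < M ∧ 0 < m ∧ 2 * m < M ∧ ℓ₀ ≤ L / M ∧ ε * M ≤ m ∧ (m : ℝ) ≤ ε * M + 1 ∧
      8 / ε ≤ M := by
  have hLℓ : 8 / ε + 2 ≤ L / ℓ₀ := by
    rw [le_div_iff₀ hℓ₀]; linarith
  have h8ε : 32 < 8 / ε := by
    rw [lt_div_iff₀ hε]; linarith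
  set M : ℕ := ⌊L / ℓ₀⌋₊ with hMdef
  have hL0 : 0 ≤ L / ℓ₀ := by linarith
  have hMle : (M : ℝ) ≤ L / ℓ₀ := Nat.floor_le hL0
  have hMgt : L / ℓ₀ < M + 1 := Nat.lt_floor_add_one _
  have hM8 : 8 / ε ≤ M := by linarith
  have hMpos : (0 : ℝ) < M := by linarith
  have hM0 : 0 < M := by exact_mod_cast hMpos
  set m : ℕ := ⌊ε * M⌋₊ + 1 with hmdef
  have hεM0 : 0 ≤ ε * M := by positivity
  have hm1 : ε * M ≤ m := by
    rw [hmdef]; push_cast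
    exact (Nat.lt_floor_add_one _).le
  have hm2 : (m : ℝ) ≤ ε * M + 1 := by
    rw [hmdef]; push_cast
    linarith [Nat.floor_le hεM0]
  refine ⟨M, m, hM0, Nat.succ_pos _, ?_, ?_, hm1, hm2, hM8⟩
  · have : (2 * m : ℝ) < M := by nlinarith
    exact_mod_cast this
  · rw [le_div_iff₀ hMpos]
    calc ℓ₀ * M ≤ ℓ₀ * (L / ℓ₀) := by gcongr
      _ = L := by field_simp

/-- **The shell fraction of the grid.** With `K_S = M³ - (M-2m)³` shell cells and `K_B = (M-2m)³` bulk
cells, the fraction `s = K_S/M³ = 1 - (1 - 2m/M)³` satisfies `2ε ≤ s ≤ 27ε/4` and `1 - s ≥ 1/16`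
when `ε ≤ m/M ≤ 9ε/8`, `ε < 1/4`. [folklore] -/
theorem shellFraction {M m : ℕ} {ε : ℝ} (hε : 0 < ε) (hε4 : ε < 1 / 4) (hM : 0 < M) (hm : 0 < m)
    (h2m : 2 * m < M) (hm1 : ε * M ≤ m) (hm2 : (m : ℝ) ≤ ε * M + 1) (hM8 : 8 / ε ≤ M) :
    0 < (M : ℝ) ^ 3 - ((M : ℝ) - 2 * m) ^ 3 ∧ 0 < ((M : ℝ) - 2 * m) ^ 3 ∧
    ((M : ℝ) ^ 3 - ((M : ℝ) - 2 * m) ^ 3) / (M : ℝ) ^ 3 ≤ 27 * ε / 4 ∧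
    2 * ε ≤ ((M : ℝ) ^ 3 - ((M : ℝ) - 2 * m) ^ 3) / (M : ℝ) ^ 3 ∧
    1 / 16 ≤ 1 - ((M : ℝ) ^ 3 - ((M : ℝ) - 2 * m) ^ 3) / (M : ℝ) ^ 3 := by
  have hMr : (0 : ℝ) < M := by exact_mod_cast hM
  have hmr : (0 : ℝ) < m := by exact_mod_cast hm
  have h2mr : (2 * m : ℝ) < M := by exact_mod_cast h2m
  set t : ℝ := m / M with ht
  have ht0 : 0 < t := by positivity
  have htm : (m : ℝ) = t * M := by rw [ht]; field_simp
  have ht2 : 2 * t < 1 := by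
    rw [ht, ← mul_div_assoc, div_lt_one hMr]; exact h2mr
  have htε : ε ≤ t := by rw [ht, le_div_iff₀ hMr]; exact hm1
  have hεM : 8 ≤ ε * M := by rwa [div_le_iff₀ hε, mul_comm] at hM8
  have h1M : 1 / (M : ℝ) ≤ ε / 8 := by
    rw [div_le_div_iff₀ hMr (by norm_num)]; linarith
  have htε' : t ≤ 9 * ε / 8 := by
    have : t ≤ ε + 1 / M := by
      rw [ht, div_le_iff₀ hMr, add_mul, one_div_mul_cancel hMr.ne']
      exact hm2
    linarith
  have hs : ((M : ℝ) ^ 3 - ((M : ℝ) - 2 * m) ^ 3) / (M : ℝ) ^ 3 = 1 - (1 - 2 * t) ^ 3 := by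
    rw [htm]; field_simp
  have hu0 : 0 < 1 - 2 * t := by linarith
  have hu7 : 7 / 16 ≤ 1 - 2 * t := by linarith
  refine ⟨?_, ?_, ?_, ?_, ?_⟩
  · have hKS : (M : ℝ) ^ 3 - ((M : ℝ) - 2 * m) ^ 3 = (M : ℝ) ^ 3 * (1 - (1 - 2 * t) ^ 3) := by
      rw [htm]; ring
    rw [hKS]
    refine mul_pos (by positivity) ?_
    have : (1 - 2 * t) ^ 3 < 1 := pow_lt_one₀ hu0.le (by linarith) three_ne_zero
    linarith
  · exact pow_pos (by linarith) 3
  · rw [hs]; nlinarith [mul_pos ht0 ht0, mul_pos (mul_pos ht0 ht0) ht0]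
  · rw [hs]
    have : 0 ≤ 4 * t * (1 - t) * (1 - 2 * t) := by
      have h1 : 0 ≤ 1 - t := by linarith
      positivity
    nlinarith [this]
  · rw [hs]
    have : (7 / 16 : ℝ) ^ 3 ≤ (1 - 2 * t) ^ 3 := pow_le_pow_left₀ (by norm_num) hu7 3
    nlinarith [this]

/-- **FREE BRANCH.** For `v` a.e. zero on `(0,∞)` the energy is the free Dirichlet energy, of size
`O(N/L²)`; the boundary-layer Poincaré inequality (`stub_boundaryLayerPoincare`, width `w = εL`) then
bounds the shell mass by `(εL)²·(E₁ + 1)N/L² = (E₁ + 1)ε²N ≤ (E₁ + 1)εN`, `E₁` the energy of the unit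
bump (tree). [folklore] -/
theorem shellMass_free (hP : Stmt.stub_boundaryLayerPoincare) {v : ℝ → ℝ≥0∞}
    (hv : IsRepulsiveFiniteRange v) (hae : ∀ᵐ r ∂(volume.restrict (Set.Ioi (0 : ℝ))), v r = 0) :
    ∃ C : ℝ, 0 < C ∧ ∀ ε : ℝ, 0 < ε → ε < 1 / 4 → ∃ ρ₀ : ℝ, 0 < ρ₀ ∧ ∀ ρ : ℝ, 0 < ρ → ρ < ρ₀ →
      ∀ᶠ N : ℕ in atTop, ∃ δ : ℝ≥0∞, 0 < δ ∧ ∀ Ψ : TrialState N (sideLength ρ N),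
        energy v Ψ ≤ groundStateEnergy v N (sideLength ρ N) + δ →
        (∑ i : Fin N, ∫⁻ X, {x : Space | ∀ j, x j ∈ Set.Ioo (ε * sideLength ρ N)
            (sideLength ρ N - ε * sideLength ρ N)}ᶜ.indicator (fun _ => (1 : ℝ≥0∞)) (X i) *
            (‖Ψ.ψ X‖₊ : ℝ≥0∞) ^ 2) ≤ ENNReal.ofReal (C * ε * N) := by
  set E₁ : ℝ := (energy 0 unitBump).toReal with hE₁
  have hE₁0 : 0 ≤ E₁ := ENNReal.toReal_nonneg
  refine ⟨E₁ + 1, by positivity, fun ε hε hε4 => ⟨1, one_pos, fun ρ hρ _ => ?_⟩⟩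
  filter_upwards [eventually_gt_atTop 0] with N hN
  have hL : 0 < sideLength ρ N := sideLength_pos' hρ hN
  have hNpos : (0 : ℝ) < N := Nat.cast_pos.2 hN
  set L := sideLength ρ N with hLdef
  have hL2 : (0 : ℝ) < L ^ 2 := by positivity
  refine ⟨ENNReal.ofReal ((N : ℝ) / L ^ 2), ENNReal.ofReal_pos.2 (by positivity), fun Ψ hΨ => ?_⟩
  have hw : 0 < ε * L := by positivity
  have h2w : 2 * (ε * L) ≤ L := by nlinarith
  have h1 := hP N L (ε * L) hw h2w Ψ
  -- the kinetic energy is at most the energy, the energy at most `E₀(0) + δ ≤ (E₁ + 1) N / L²`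
  have hkin : ∫⁻ X, kineticDensity Ψ.ψ X ≤ energy v Ψ := lintegral_mono fun X => le_self_add
  have hE0 : groundStateEnergy v N L ≤ ENNReal.ofReal (E₁ * N / L ^ 2) := by
    rw [groundStateEnergy_eq_zero hv hae N L]
    refine (groundStateEnergy_zero_le hL N).trans (le_of_eq ?_)
    rw [energy_unitBump_eq_ofReal, ← hE₁, ← ENNReal.ofReal_natCast,
      ← ENNReal.ofReal_mul N.cast_nonneg, ← ENNReal.ofReal_mul (inv_nonneg.2 hL2.le)]
    congr 1
    field_simp
  have hkinE : ENNReal.ofReal ((ε * L) ^ 2) * ∫⁻ X, kineticDensity Ψ.ψ X ≤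
      ENNReal.ofReal ((ε * L) ^ 2) *
        (ENNReal.ofReal (E₁ * N / L ^ 2) + ENNReal.ofReal ((N : ℝ) / L ^ 2)) := by
    gcongr
    exact hkin.trans (hΨ.trans (add_le_add hE0 le_rfl))
  calc _ ≤ _ := h1
    _ ≤ _ := hkinE
    _ = ENNReal.ofReal ((ε * L) ^ 2 * (E₁ * N / L ^ 2 + N / L ^ 2)) := by
        rw [← ENNReal.ofReal_add (by positivity) (by positivity),
          ← ENNReal.ofReal_mul (by positivity)]
    _ ≤ ENNReal.ofReal ((E₁ + 1) * ε * N) := by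
        refine ENNReal.ofReal_le_ofReal ?_
        have hid : (ε * L) ^ 2 * (E₁ * N / L ^ 2 + N / L ^ 2) = ε ^ 2 * ((E₁ + 1) * N) := by
          field_simp
        rw [hid]
        have hX : 0 ≤ (E₁ + 1) * N := by positivity
        have hε1 : ε ^ 2 ≤ ε := by nlinarith
        nlinarith [mul_le_mul_of_nonneg_right hε1 hX]

/-- **INTERACTING BRANCH** (`a(v) > 0`): grid + minorant + Jensen + Dyson + algebra give the shell bound
with `C = 12`. [folklore] -/
theorem shellMass_interacting (hJ : Stmt.stub_gridJensen) (hMin : Stmt.stub_cellMinorant)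
    {v : ℝ → ℝ≥0∞} (hv : IsRepulsiveFiniteRange v)
    (hne : ¬ (∀ᵐ r ∂(volume.restrict (Set.Ioi (0 : ℝ))), v r = 0)) :
    ∀ ε : ℝ, 0 < ε → ε < 1 / 4 → ∃ ρ₀ : ℝ, 0 < ρ₀ ∧ ∀ ρ : ℝ, 0 < ρ → ρ < ρ₀ →
      ∀ᶠ N : ℕ in atTop, ∃ δ : ℝ≥0∞, 0 < δ ∧ ∀ Ψ : TrialState N (sideLength ρ N),
        energy v Ψ ≤ groundStateEnergy v N (sideLength ρ N) + δ →
        (∑ i : Fin N, ∫⁻ X, {x : Space | ∀ j, x j ∈ Set.Ioo (ε * sideLength ρ N)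
            (sideLength ρ N - ε * sideLength ρ N)}ᶜ.indicator (fun _ => (1 : ℝ≥0∞)) (X i) *
            (‖Ψ.ψ X‖₊ : ℝ≥0∞) ^ 2) ≤ ENNReal.ofReal (12 * ε * N) := by
  have hatop : scatteringLength v ≠ ⊤ := hv.scatteringLength_ne_top
  have ha0 : scatteringLength v ≠ 0 :=
    Summit.AtomisticToContinuum.BoseEinsteinCondensation.Theorems.scatteringLength_ne_zero_of_not_ae_zero
      hv hne
  have hapos : 0 < scatteringLength v := pos_iff_ne_zero.2 ha0
  obtain ⟨R₀, hR₀⟩ := hv.2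
  obtain ⟨CU, ρU, hCU, hρU, hDy⟩ := eventually_groundStateEnergy_le_dyson hR₀ hv.1 hatop hapos
  set a : ℝ := (scatteringLength v).toReal with ha_def
  have ha : 0 < a := ENNReal.toReal_pos ha0 hatop
  intro ε hε hε4
  have hη : 0 < ε / 8 := by positivity
  have hη1 : ε / 8 < 1 := by linarith
  obtain ⟨ρ₁, hρ₁, hMin1⟩ := hMin v hv hatop hapos (ε / 8) hη hη1
  set ρD : ℝ := (ε / (8 * CU)) ^ 3 / a ^ 3 with hρD
  have hρD0 : 0 < ρD := by positivity
  have hρE0 : 0 < ρ₁ * ε / 16 := by positivity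
  refine ⟨min ρU (min ρD (ρ₁ * ε / 16)), lt_min hρU (lt_min hρD0 hρE0), fun ρ hρ hρlt => ?_⟩
  have hρU' : ρ < ρU := hρlt.trans_le (min_le_left _ _)
  have hρD' : ρ < ρD := hρlt.trans_le ((min_le_right _ _).trans (min_le_left _ _))
  have hρ1' : ρ < ρ₁ * ε / 16 := hρlt.trans_le ((min_le_right _ _).trans (min_le_right _ _))
  set P : ℝ := 4 * Real.pi * a with hPdef
  have hP0 : 0 < P := by positivity
  obtain ⟨ℓ₀, hℓ₀, hMin2⟩ := hMin1 (P * ρ ^ 2 * (ε / 8)) (by positivity)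
  -- Dyson's relative error is below `ε/8` at these densities
  have hY : CU * (ρ * a ^ 3) ^ ((1 : ℝ) / 3) ≤ ε / 8 := by
    have h1 : ρ * a ^ 3 < (ε / (8 * CU)) ^ 3 := by
      rwa [hρD, lt_div_iff₀ (by positivity)] at hρD'
    have h2 : (ρ * a ^ 3) ^ ((1 : ℝ) / 3) < ε / (8 * CU) := by
      calc (ρ * a ^ 3) ^ ((1 : ℝ) / 3) < ((ε / (8 * CU)) ^ 3) ^ ((1 : ℝ) / 3) :=
            Real.rpow_lt_rpow (by positivity) h1 (by norm_num)
        _ = ε / (8 * CU) := by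
            rw [show ((1 : ℝ) / 3) = ((3 : ℕ) : ℝ)⁻¹ by norm_num,
              Real.pow_rpow_inv_natCast (by positivity) (by norm_num)]
    have h3 : CU * (ρ * a ^ 3) ^ ((1 : ℝ) / 3) ≤ CU * (ε / (8 * CU)) :=
      (mul_lt_mul_of_pos_left h2 hCU).le
    have h4 : CU * (ε / (8 * CU)) = ε / 8 := by field_simp
    rwa [h4] at h3
  have hLN : ∀ᶠ N : ℕ in atTop, ℓ₀ * (8 / ε + 2) ≤ sideLength ρ N :=
    (tendsto_sideLength_atTop hρ).eventually (eventually_ge_atTop _)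
  filter_upwards [hDy ρ hρ hρU', eventually_gt_atTop 0, hLN] with N hDyN hN hLN'
  have hL : 0 < sideLength ρ N := sideLength_pos' hρ hN
  have hNpos : (0 : ℝ) < N := Nat.cast_pos.2 hN
  have hL3 : sideLength ρ N ^ 3 = N / ρ := sideLength_pow_three hρ N
  set L := sideLength ρ N with hLdef
  refine ⟨ENNReal.ofReal (P * ρ * N * (ε / 8)), ENNReal.ofReal_pos.2 (by positivity),
    fun Ψ hΨ => ?_⟩
  -- the grid, the minorant at cell size `L/M`, the Jensen bound
  obtain ⟨M, m, hM0, hm0, h2m, hℓM, hm1, hm2, hM8⟩ := grid_choice hε hε4 hℓ₀ hLN'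
  have hMr : (0 : ℝ) < M := by exact_mod_cast hM0
  obtain ⟨hKS, hKB, hs27, hs2, hs16⟩ := shellFraction hε hε4 hM0 hm0 h2m hm1 hm2 hM8
  have hℓpos : 0 < L / M := div_pos hL hMr
  obtain ⟨g, hconv, hg0, hmin, hquad⟩ := hMin2 (L / M) hℓM
  have hJΨ := hJ v hv.1 N M m L hL hm0 h2m g hconv hg0 hmin Ψ
  -- names
  set Sm : ℝ≥0∞ := ∑ i : Fin N, ∫⁻ X, {x : Space | ∀ j, x j ∈ Set.Ioo ((m : ℝ) * (L / M))
      (L - (m : ℝ) * (L / M))}ᶜ.indicator (fun _ => (1 : ℝ≥0∞)) (X i) * (‖Ψ.ψ X‖₊ : ℝ≥0∞) ^ 2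
    with hSmdef
  set KS : ℝ := (M : ℝ) ^ 3 - ((M : ℝ) - 2 * m) ^ 3 with hKSdef
  set KB : ℝ := ((M : ℝ) - 2 * m) ^ 3 with hKBdef
  set s : ℝ := KS / (M : ℝ) ^ 3 with hsdef
  have hSmN : Sm ≤ (N : ℝ≥0∞) := shellMass_le Ψ _
  have hSmtop : Sm ≠ ⊤ := ne_top_of_le_ne_top (ENNReal.natCast_ne_top N) hSmN
  set S : ℝ := Sm.toReal with hSdef
  have hS0 : 0 ≤ S := ENNReal.toReal_nonneg
  have hSN : S ≤ N := by
    have := ENNReal.toReal_mono (ENNReal.natCast_ne_top N) hSmN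
    simpa using this
  -- upper bound: `energy ≤ E₀ + δ ≤ PρN(1 + CY) + PρN ε/8`
  have hup : energy v Ψ ≤ ENNReal.ofReal (P * ρ * N * (1 + CU * (ρ * a ^ 3) ^ ((1 : ℝ) / 3))) +
      ENNReal.ofReal (P * ρ * N * (ε / 8)) := by
    refine hΨ.trans (add_le_add (hDyN.trans (le_of_eq ?_)) le_rfl)
    congr 1; rw [hPdef]; ring
  have hB0 : 0 ≤ P * ρ * N * (1 + CU * (ρ * a ^ 3) ^ ((1 : ℝ) / 3)) := by positivity
  have hB1 : 0 ≤ P * ρ * N * (ε / 8) := by positivity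
  have hE1 : KS * g (S / KS) + KB * g ((N - S) / KB) ≤
      P * ρ * N * (1 + CU * (ρ * a ^ 3) ^ ((1 : ℝ) / 3)) + P * ρ * N * (ε / 8) := by
    have h := hJΨ.trans hup
    rw [← ENNReal.ofReal_add hB0 hB1] at h
    exact (ENNReal.ofReal_le_ofReal_iff (add_nonneg hB0 hB1)).1 h
  -- volumes
  have hM3 : (0 : ℝ) < (M : ℝ) ^ 3 := by positivity
  have hsKS : KS = s * (M : ℝ) ^ 3 := by rw [hsdef]; field_simp
  have hsKB : KB = (1 - s) * (M : ℝ) ^ 3 := by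
    have h1 : KS + KB = (M : ℝ) ^ 3 := by rw [hKSdef, hKBdef]; ring
    rw [hsKS] at h1
    linear_combination h1
  have hVS : KS * (L / M) ^ 3 = s * (N / ρ) := by
    rw [hsKS, ← hL3]; field_simp
  have hVB : KB * (L / M) ^ 3 = (1 - s) * (N / ρ) := by
    rw [hsKB, ← hL3]; field_simp
  have hs0 : 0 < s := div_pos hKS hM3
  have hs1 : s < 1 := by linarith only [hs16]
  -- the two average occupations are in the dilute range of the minorant
  have hρs : ρ ≤ ρ₁ * s := by
    have h1 := mul_le_mul_of_nonneg_left hs2 hρ₁.le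
    have h2 : 0 < ρ₁ * ε := mul_pos hρ₁ hε
    linarith only [h1, h2, hρ1']
  have hρs' : ρ ≤ ρ₁ * (1 - s) := by
    have h1 := mul_le_mul_of_nonneg_left hs16 hρ₁.le
    have h2 : ρ₁ * ε ≤ ρ₁ * 1 := mul_le_mul_of_nonneg_left (by linarith only [hε4]) hρ₁.le
    have h3 : 0 < ρ₁ * ε := mul_pos hρ₁ hε
    linarith only [h1, h2, h3, hρ1']
  have harg1 : S / KS ≤ ρ₁ * (L / M) ^ 3 := by
    rw [div_le_iff₀ hKS]
    have h1 : (N : ℝ) ≤ ρ₁ * (s * (N / ρ)) := by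
      rw [show ρ₁ * (s * (N / ρ)) = (ρ₁ * s / ρ) * N by ring]
      have : 1 ≤ ρ₁ * s / ρ := by rw [le_div_iff₀ hρ, one_mul]; exact hρs
      exact le_mul_of_one_le_left hNpos.le this
    calc S ≤ N := hSN
      _ ≤ ρ₁ * (s * (N / ρ)) := h1
      _ = ρ₁ * (L / M) ^ 3 * KS := by rw [← hVS]; ring
  have harg2 : ((N : ℝ) - S) / KB ≤ ρ₁ * (L / M) ^ 3 := by
    rw [div_le_iff₀ hKB]
    have h1 : (N : ℝ) ≤ ρ₁ * ((1 - s) * (N / ρ)) := by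
      rw [show ρ₁ * ((1 - s) * (N / ρ)) = (ρ₁ * (1 - s) / ρ) * N by ring]
      have : 1 ≤ ρ₁ * (1 - s) / ρ := by rw [le_div_iff₀ hρ, one_mul]; exact hρs'
      exact le_mul_of_one_le_left hNpos.le this
    calc (N : ℝ) - S ≤ N := by linarith only [hS0]
      _ ≤ ρ₁ * ((1 - s) * (N / ρ)) := h1
      _ = ρ₁ * (L / M) ^ 3 * KB := by rw [← hVB]; ring
  have hg₁ := hquad (S / KS) (div_nonneg hS0 hKS.le) harg1
  have hg₂ := hquad (((N : ℝ) - S) / KB) (div_nonneg (by linarith only [hSN]) hKB.le) harg2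
  -- the algebra
  have hmain : S ≤ (3 * s + ε) / 2 * N :=
    algebra hP0 hρ hNpos hε (by linarith) hs0 hs1 hS0 hKS hKB hℓpos hVS hVB hY hE1 hg₁ hg₂
  have hS12 : S ≤ 12 * ε * N := by
    have h1 : (3 * s + ε) / 2 ≤ 12 * ε := by linarith only [hs27, hε]
    have h2 := mul_le_mul_of_nonneg_right h1 hNpos.le
    linarith only [hmain, h2]
  -- conclude: the crux's shell (width `εL`) lies inside the grid shell (width `mL/M ≥ εL`)
  have hεm : ε * L ≤ (m : ℝ) * (L / M) := by
    have : ε * L = ε * M * (L / M) := by field_simp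
    rw [this]
    exact mul_le_mul_of_nonneg_right hm1 hℓpos.le
  calc _ ≤ Sm := shellMass_mono Ψ hεm
    _ = ENNReal.ofReal S := (ENNReal.ofReal_toReal hSmtop).symm
    _ ≤ ENNReal.ofReal (12 * ε * N) := ENNReal.ofReal_le_ofReal hS12

/-- **The crux from the stubs** (kernel-checked composition, no `sorry` of its own): split on whether
`v` is a.e. zero on `(0, ∞)`. [folklore] -/
theorem becShellMass_of_stubs (hP : Stmt.stub_boundaryLayerPoincare) (hJ : Stmt.stub_gridJensen)
    (hM : Stmt.stub_cellMinorant) : BECInfraredBound.BecShellMass := by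
  intro v hv
  by_cases hae : (∀ᵐ r ∂(volume.restrict (Set.Ioi (0 : ℝ))), v r = 0)
  · exact shellMass_free hP hv hae
  · exact ⟨12, by norm_num, shellMass_interacting hJ hM hv hae⟩

/-- The crux BY NAME from the three registered stubs. [folklore] -/
theorem BecShellMass_of : BECInfraredBound.BecShellMass :=
  becShellMass_of_stubs stub_boundaryLayerPoincare stub_gridJensen stub_cellMinorant

end Summit.AtomisticToContinuum.BoseEinsteinCondensation.Cruxes.BecShellMass.CellJensen

end
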